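import Summits.AtomisticToContinuum.HydrodynamicLimit.Theorems.InformationPercolationEngineChaosClosesEulerPressureValueE
import Summits.AtomisticToContinuum.HydrodynamicLimit.Theorems.InformationPercolationEngineChaosClosesEulerPressureValueF
import Summits.AtomisticToContinuum.HydrodynamicLimit.Theorems.InformationPercolationEngineChaosClosesEulerStressIsotropyD
import Summits.AtomisticToContinuum.HydrodynamicLimit.Theorems.JParityClosureEvenStressEnskogTubeStatRegular
import Summits.AtomisticToContinuum.HydrodynamicLimit.Theorems.JParityClosureLocalSecondLawKineticStressAlgebra
import HarnessLib

/-!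
# Collisional pressure value in band (crux `ChaosClosesEuler`, stmt-AtomisticToContinuum-15141, line `Sketch`,
# stub `stub_pressureValueOfEnskog`) — helper H: fields along a good orbit; the layer estimate on the Enskog side

WHAT. (1) The atoms of the Enskog side read along ONE good orbit `s ↦ Φₛz` — the cone fields, the pair functional of a
continuous mark, the contact value `Y(σ³ρ_r)`, the smoothed coefficient `ã` — are jointly measurable in `(s, x)` and
bounded (by `r`-, `L`- and energy-dependent constants; only SOME bound is needed), so that the Fubini toolkit of helper
E applies to every space–time integral below. (2) `abs_windowSide_sub_instSide_le` — THE LAYER ESTIMATE ON THE ENSKOG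
SIDE: replacing the smoothed coefficient `ã` (window `[0, t+1]`) by the instantaneous one `a 1{s ≤ t}` costs
`σ³ B₁ (ω (t+1) + 6 A r)`, where `ω` is a joint `r`-modulus of `a`, `A = sup |a|` and `B₁` bounds the space integral of
`|F|` at every instant (interior `s ∈ [r, t − r]` by the modulus, the three boundary layers of total length `3r` by
`2A`, nothing past `t + r`).

References: elementary measure theory; C. Cercignani, R. Illner, M. Pulvirenti (1994) App. 4.A (window reduction).
-/

noncomputable section

namespace Summit.AtomisticToContinuum.HydrodynamicLimit.Theorems.ChaosClosesEulerPressureValue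

open scoped BigOperators Topology Classical MeasureTheory ENNReal InnerProductSpace
open Filter Set MeasureTheory
open Literature.MathematicalPhysics.KineticTheory
open Literature.Analysis.FluidPDE
open Summit.AtomisticToContinuum.HydrodynamicLimit.Theorems.LocalSecondLawNegative
open Summit.AtomisticToContinuum.HydrodynamicLimit.Theorems.LocalSecondLawLedger
open Summit.AtomisticToContinuum.HydrodynamicLimit.Theorems.LocalSecondLawLedger.L
  (Mmom rhoC_eq_sum momC_apply_eq_sum momC_eq_sum kinC_eq_trace norm_sq_eq_sum)

/-- The truncated stress mark `𝒯[L,k,l]` (local notation for an explicit lambda). -/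
local notation3 "𝒯[" L ", " k ", " l "]" => fun q : V3 × V3 × V3 =>
  min |⟪q.2.1 - q.2.2, q.1⟫_ℝ| (4 * L) * (speedCutoff L ‖q.2.1‖ * speedCutoff L ‖q.2.2‖) * (clip1 (q.1 k) * clip1 (q.1 l))

/-- The dominating mark `ℬ[L]` (local notation for an explicit lambda). -/
local notation3 "ℬ[" L "]" => fun q : V3 × V3 × V3 => 4 * L * (speedCutoff L ‖q.2.1‖ * speedCutoff L ‖q.2.2‖)

section Orbit

open Function
open Summit.AtomisticToContinuum.HydrodynamicLimit.Theorems.ChaosClosesEulerStressIsotropy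

variable {σ : ℝ} {N : ℕ} (Φ : HardSphereFlow (Torus.geometry (Fin 3)) (hsDiameter σ N) (N + 1)) {z : Phase N}

/-! ## §1 Atoms along a good orbit -/

/-- The pair functional of a mark with continuous sphere integral, read along a good orbit, is jointly measurable in
`(s, x)`. [folklore] -/
theorem measurable_pairFunctional_orbit (hz : z ∈ Φ.good) {Ξ : V3 × V3 × V3 → ℝ}
    (hΞ : Continuous fun p : V3 × V3 => sphereMark Ξ p.1 p.2) (r : ℝ) :
    Measurable fun p : ℝ × T3 => pairFunctional r Ξ (Φ.flow p.1 z) p.2 := by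
  have hγ := measurable_flow_of_mem_good Φ hz
  have h : (fun p : ℝ × T3 => pairFunctional r Ξ (Φ.flow p.1 z) p.2) = fun p =>
      ((N + 1 : ℕ) : ℝ)⁻¹ * ((N + 1 : ℕ) : ℝ)⁻¹ * ∑ i, ∑ j, coneKernel r ((Φ.flow p.1 z) i).1 p.2 *
        coneKernel r ((Φ.flow p.1 z) j).1 p.2 * sphereMark Ξ ((Φ.flow p.1 z) i).2 ((Φ.flow p.1 z) j).2 :=
    funext fun p => pairFunctional_eq_double_sum r Ξ _ _
  rw [h]
  refine measurable_const.mul (Finset.measurable_sum _ fun i _ => Finset.measurable_sum _ fun j _ => ?_)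
  have hi : Measurable fun s : ℝ => Φ.flow s z i := (measurable_pi_apply i).comp hγ
  have hj : Measurable fun s : ℝ => Φ.flow s z j := (measurable_pi_apply j).comp hγ
  exact ((measurable_coneKernel_comp r (hi.fst.comp measurable_fst) measurable_snd).mul
    (measurable_coneKernel_comp r (hj.fst.comp measurable_fst) measurable_snd)).mul
    (hΞ.measurable.comp ((hi.snd.comp measurable_fst).prodMk (hj.snd.comp measurable_fst)))

/-- Along a good orbit `e_r(Φₛz, x) ≤ 3/(πr³) ke(z)` (energy conservation). [folklore] -/
theorem kinC_flow_le (hz : z ∈ Φ.good) {r : ℝ} (hr : 0 < r) (s : ℝ) (x : T3) :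
    kinC r (Φ.flow s z) x ≤ 3 / (Real.pi * r ^ 3) * ke z := by
  rw [← ke_flow_eq Φ hz s]; exact psvK_kinC_le hr _ x

/-- `MpsiC (sqTail L) ≤ 2 e_r`. [folklore] -/
theorem MpsiC_sqTail_le_two_kinC {r : ℝ} (hr : 0 < r) (w : Phase N) (x : T3) (L : ℝ) :
    MpsiC r w x (sqTail L) ≤ 2 * kinC r w x := by
  rw [two_mul_kinC_eq_MpsiC]; exact MpsiC_mono hr w x fun v => sqTail_le_norm_sq L v

/-- `0 ≤ MpsiC (sqTail L)`. [folklore] -/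
theorem MpsiC_sqTail_nonneg {r : ℝ} (hr : 0 < r) (w : Phase N) (x : T3) (L : ℝ) : 0 ≤ MpsiC r w x (sqTail L) :=
  MpsiC_nonneg hr w x fun v => sqTail_nonneg L v

/-- `|ρ_r² θ_r| ≤ (2/(πr³)) e_r`-type bound: `0 ≤ ρ_r²θ_r ≤ (3/(πr³)) (2/3) e_r`. [folklore] -/
theorem rhoC_sq_mul_thetaC_mem {r : ℝ} (hr : 0 < r) (w : Phase N) (x : T3) :
    0 ≤ rhoC r w x ^ 2 * thetaC r w x ∧ rhoC r w x ^ 2 * thetaC r w x ≤ 3 / (Real.pi * r ^ 3) * (2 / 3 * kinC r w x) := by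
  have h0 := psvK_rhoC_mul_thetaC_nonneg hr w x
  have h1 := psvK_rhoC_mul_thetaC_le hr w x
  have hρ := rhoC_nonneg hr w x
  have hρ' := ChaosClosesEulerReduction.rhoC_le hr w x
  have e : rhoC r w x ^ 2 * thetaC r w x = rhoC r w x * (rhoC r w x * thetaC r w x) := by ring
  rw [e]
  exact ⟨mul_nonneg hρ h0, mul_le_mul hρ' h1 h0 (by positivity)⟩

/-! ## §2 The smoothed coefficient is jointly measurable -/

/-- **The smoothed coefficient `ã(s, x) = ∫_{t₀ ∈ [0,t]} ∫_{x₀} a(t₀,x₀) bt(s − t₀) b_r(x, x₀)` of a bounded continuous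
`a` is jointly measurable in `(s, x)`** (Fubini measurability of a parametric integral over the finite window measure).
[folklore] -/
theorem measurable_smoothCoeff {a : ℝ × T3 → ℝ} (ha : Continuous a) {A : ℝ} (hA : ∀ p, |a p| ≤ A) {r : ℝ}
    (hr : 0 < r) (t : ℝ) :
    Measurable (uncurry fun (s : ℝ) (x : T3) =>
      ∫ t₀ in Icc 0 t, ∫ x₀, a (t₀, x₀) * (r⁻¹ * max (1 - |s - t₀| / r) 0 * cone r x x₀)) := by
  set K : (ℝ × T3) × (ℝ × T3) → ℝ := fun v =>
    a v.1 * (r⁻¹ * max (1 - |v.2.1 - v.1.1| / r) 0 * cone r v.2.2 v.1.2) with hK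
  have hKm : Measurable K := by
    have h := measurable_windowKernel ha r (F := fun _ _ => (1 : ℝ)) measurable_const
    simpa only [mul_one] using h
  have hA0 : 0 ≤ A := (abs_nonneg _).trans (hA (0, 0))
  have hKb : ∀ v, ‖K v‖ ≤ A * (r⁻¹ * (3 / (Real.pi * r ^ 3))) := by
    intro v
    rw [Real.norm_eq_abs, hK]
    dsimp only
    have ht := ChaosClosesEulerWindowedInvariance.tent_nonneg_le hr (v.2.1 - v.1.1)
    have hc0 := cone_nonneg hr v.2.2 v.1.2
    have hc1 : cone r v.2.2 v.1.2 ≤ 3 / (Real.pi * r ^ 3) :=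
      (le_abs_self _).trans (LocalSecondLawLedger.L.abs_cone_le hr v.2.2 v.1.2)
    rw [abs_mul, abs_mul, abs_of_nonneg ht.1, abs_of_nonneg hc0]
    exact mul_le_mul (hA _) (mul_le_mul ht.2 hc1 hc0 (inv_nonneg.2 hr.le)) (mul_nonneg ht.1 hc0) hA0
  set μ₁ : Measure (ℝ × T3) := (volume.restrict (Icc 0 t)).prod volume with hμ₁
  haveI : IsFiniteMeasure ((volume : Measure ℝ).restrict (Icc 0 t)) :=
    ⟨by rw [Measure.restrict_apply_univ, Real.volume_Icc]; exact ENNReal.ofReal_lt_top⟩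
  have hsm : StronglyMeasurable fun q : ℝ × T3 => ∫ p, K (p, q) ∂μ₁ := hKm.stronglyMeasurable.integral_prod_left'
  have heq : (uncurry fun (s : ℝ) (x : T3) =>
      ∫ t₀ in Icc 0 t, ∫ x₀, a (t₀, x₀) * (r⁻¹ * max (1 - |s - t₀| / r) 0 * cone r x x₀)) =
      fun q : ℝ × T3 => ∫ p, K (p, q) ∂μ₁ := by
    funext q
    have hInt : Integrable (fun p : ℝ × T3 => K (p, q)) μ₁ :=
      Integrable.of_bound (hKm.comp (measurable_id.prodMk measurable_const)).aestronglyMeasurable _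
        (ae_of_all _ fun p => hKb _)
    rw [hμ₁, integral_prod _ hInt]
    rfl
  rw [heq]
  exact hsm.measurable

end Orbit

/-! ## §3 The layer estimate on the Enskog side -/

section Layer

open Function

/-- The layer weight `c(s) = ω + 2A (1_{[0,r]}(s) + 1_{[t−r,t+r]}(s))`, its measurability. [folklore] -/
theorem measurable_layerWeight (ω A r t : ℝ) :
    Measurable fun s : ℝ => ω + 2 * A * ((Icc 0 r).indicator (fun _ => (1 : ℝ)) s +
      (Icc (t - r) (t + r)).indicator (fun _ => (1 : ℝ)) s) :=
  measurable_const.add (measurable_const.mul ((measurable_const.indicator measurableSet_Icc).add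
    (measurable_const.indicator measurableSet_Icc)))

/-- The layer weight lies in `[0, ω + 4A]` for `ω, A ≥ 0`. [folklore] -/
theorem layerWeight_mem {ω A : ℝ} (hω : 0 ≤ ω) (hA : 0 ≤ A) (r t s : ℝ) :
    0 ≤ ω + 2 * A * ((Icc 0 r).indicator (fun _ => (1 : ℝ)) s + (Icc (t - r) (t + r)).indicator (fun _ => (1 : ℝ)) s) ∧
      ω + 2 * A * ((Icc 0 r).indicator (fun _ => (1 : ℝ)) s + (Icc (t - r) (t + r)).indicator (fun _ => (1 : ℝ)) s) ≤
        ω + 4 * A := by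
  have h1 : 0 ≤ (Icc 0 r).indicator (fun _ => (1 : ℝ)) s ∧ (Icc 0 r).indicator (fun _ => (1 : ℝ)) s ≤ 1 := by
    by_cases h : s ∈ Icc 0 r
    · rw [Set.indicator_of_mem h]; exact ⟨zero_le_one, le_rfl⟩
    · rw [Set.indicator_of_notMem h]; exact ⟨le_rfl, zero_le_one⟩
  have h2 : 0 ≤ (Icc (t - r) (t + r)).indicator (fun _ => (1 : ℝ)) s ∧
      (Icc (t - r) (t + r)).indicator (fun _ => (1 : ℝ)) s ≤ 1 := by
    by_cases h : s ∈ Icc (t - r) (t + r)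
    · rw [Set.indicator_of_mem h]; exact ⟨zero_le_one, le_rfl⟩
    · rw [Set.indicator_of_notMem h]; exact ⟨le_rfl, zero_le_one⟩
  constructor <;> nlinarith [h1.1, h1.2, h2.1, h2.2]

/-- The window integral of the layer weight: `∫_{s ∈ [0,τ]} c(s) ds ≤ ω τ + 6 A r` (`0 ≤ τ`, `A, r ≥ 0`). [folklore] -/
theorem setIntegral_layerWeight_le {ω A r τ : ℝ} (hA : 0 ≤ A) (hr : 0 ≤ r) (hτ : 0 ≤ τ) (t : ℝ) :
    ∫ s in Icc 0 τ, (ω + 2 * A * ((Icc 0 r).indicator (fun _ => (1 : ℝ)) s +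
      (Icc (t - r) (t + r)).indicator (fun _ => (1 : ℝ)) s)) ≤ ω * τ + 6 * A * r := by
  have hfin : ∀ a b : ℝ, IsFiniteMeasure ((volume : Measure ℝ).restrict (Icc a b)) := fun a b =>
    ⟨by rw [Measure.restrict_apply_univ, Real.volume_Icc]; exact ENNReal.ofReal_lt_top⟩
  haveI := hfin 0 τ
  have hI1 : IntegrableOn (fun s => (Icc 0 r).indicator (fun _ => (1 : ℝ)) s) (Icc 0 τ) volume :=
    (integrable_const (1 : ℝ)).indicator measurableSet_Icc
  have hI2 : IntegrableOn (fun s => (Icc (t - r) (t + r)).indicator (fun _ => (1 : ℝ)) s) (Icc 0 τ) volume :=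
    (integrable_const (1 : ℝ)).indicator measurableSet_Icc
  have e1 : ∫ s in Icc 0 τ, (Icc 0 r).indicator (fun _ => (1 : ℝ)) s ≤ r := by
    rw [setIntegral_indicator measurableSet_Icc, setIntegral_const, smul_eq_mul, mul_one]
    calc (volume : Measure ℝ).real (Icc 0 τ ∩ Icc 0 r) ≤ (volume : Measure ℝ).real (Icc 0 r) :=
          measureReal_mono Set.inter_subset_right (by rw [Real.volume_Icc]; exact ENNReal.ofReal_ne_top)
      _ = r := by rw [measureReal_def, Real.volume_Icc, ENNReal.toReal_ofReal (by linarith), sub_zero]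
  have e2 : ∫ s in Icc 0 τ, (Icc (t - r) (t + r)).indicator (fun _ => (1 : ℝ)) s ≤ 2 * r := by
    rw [setIntegral_indicator measurableSet_Icc, setIntegral_const, smul_eq_mul, mul_one]
    calc (volume : Measure ℝ).real (Icc 0 τ ∩ Icc (t - r) (t + r)) ≤ (volume : Measure ℝ).real (Icc (t - r) (t + r)) :=
          measureReal_mono Set.inter_subset_right (by rw [Real.volume_Icc]; exact ENNReal.ofReal_ne_top)
      _ = 2 * r := by
          rw [measureReal_def, Real.volume_Icc, ENNReal.toReal_ofReal (by linarith)]; ring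
  have e0 : ∫ _ in Icc 0 τ, ω = ω * τ := by
    rw [setIntegral_const, measureReal_def, Real.volume_Icc, ENNReal.toReal_ofReal (by linarith), smul_eq_mul,
      sub_zero, mul_comm]
  have hI12 : IntegrableOn (fun s => 2 * A * ((Icc 0 r).indicator (fun _ => (1 : ℝ)) s +
      (Icc (t - r) (t + r)).indicator (fun _ => (1 : ℝ)) s)) (Icc 0 τ) volume := (hI1.add hI2).const_mul (2 * A)
  have hadd := integral_add (μ := (volume : Measure ℝ).restrict (Icc 0 τ)) (integrable_const ω) hI12
  beta_reduce at hadd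
  have hadd2 := integral_add (μ := (volume : Measure ℝ).restrict (Icc 0 τ)) hI1 hI2
  beta_reduce at hadd2
  rw [hadd, integral_const_mul, hadd2, e0]
  nlinarith [e1, e2]

/-- **The layer estimate on the Enskog side.** For a bounded continuous coefficient `a` (`|a| ≤ A`) with joint
`r`-modulus `ω`, a bounded jointly measurable field `F` with `∫ₓ |F(s, ·)| ≤ B₁` at every instant, `0 ≤ t`,
`0 < r < 1/2`:
`|∫_{s ∈ [0,t+1]} ∫_x ã(s,x) F(s,x) − ∫_{s ∈ [0,t]} ∫_x a(s,x) F(s,x)| ≤ B₁ (ω (t+1) + 6 A r)`. [folklore] -/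
theorem abs_windowSide_sub_instSide_le {a : ℝ × T3 → ℝ} (ha : Continuous a) {A : ℝ} (hA : ∀ p, |a p| ≤ A)
    {r : ℝ} (hr : 0 < r) (hr2 : r < 1 / 2) {t : ℝ} (ht : 0 ≤ t) {ω : ℝ} (hω0 : 0 ≤ ω)
    (hω : ∀ (s t₀ : ℝ) (x x₀ : T3), |s - t₀| < r → Torus.euclidDist x x₀ < r → |a (t₀, x₀) - a (s, x)| ≤ ω)
    {F : ℝ → T3 → ℝ} (hF : Measurable (uncurry F)) {C : ℝ} (hFb : ∀ s x, |F s x| ≤ C) {B₁ : ℝ}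
    (hB₁ : ∀ s, ∫ x, |F s x| ≤ B₁) :
    |(∫ s in Icc 0 (t + 1), ∫ x, (∫ t₀ in Icc 0 t, ∫ x₀,
        a (t₀, x₀) * (r⁻¹ * max (1 - |s - t₀| / r) 0 * cone r x x₀)) * F s x) -
      ∫ s in Icc 0 t, ∫ x, a (s, x) * F s x| ≤ B₁ * (ω * (t + 1) + 6 * A * r) := by
  have hA0 : 0 ≤ A := (abs_nonneg _).trans (hA (0, 0))
  have hC0 : 0 ≤ C := (abs_nonneg _).trans (hFb 0 0)
  have hB₁0 : 0 ≤ B₁ := (integral_nonneg fun x => abs_nonneg _).trans (hB₁ 0)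
  -- the smoothed and the cut coefficients as bounded measurable fields
  set at' : ℝ → T3 → ℝ := fun s x => ∫ t₀ in Icc 0 t, ∫ x₀,
    a (t₀, x₀) * (r⁻¹ * max (1 - |s - t₀| / r) 0 * cone r x x₀) with hat'
  set ac : ℝ → T3 → ℝ := fun s x => (Iic t).indicator (fun s => a (s, x)) s with hac
  have hat'm : Measurable (uncurry at') := measurable_smoothCoeff ha hA hr t
  have hat'b : ∀ s x, |at' s x| ≤ A := fun s x => abs_smoothCoeff_le ha hr hr2 hA t s x
  have hacm : Measurable (uncurry ac) := by
    have h1 : Measurable fun p : ℝ × T3 => a p := ha.measurable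
    have h2 : Measurable fun p : ℝ × T3 => (Iic t).indicator (fun _ => (1 : ℝ)) p.1 :=
      (measurable_const.indicator measurableSet_Iic).comp measurable_fst
    have heq : uncurry ac = fun p : ℝ × T3 => a p * (Iic t).indicator (fun _ => (1 : ℝ)) p.1 := by
      funext p
      simp only [uncurry, hac]
      by_cases h : p.1 ∈ Iic t
      · rw [Set.indicator_of_mem h, Set.indicator_of_mem h, mul_one]
      · rw [Set.indicator_of_notMem h, Set.indicator_of_notMem h, mul_zero]
    rw [heq]; exact h1.mul h2
  have hacb : ∀ s x, |ac s x| ≤ A := by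
    intro s x
    rw [hac]; dsimp only
    by_cases h : s ∈ Iic t
    · rw [Set.indicator_of_mem h]; exact hA _
    · rw [Set.indicator_of_notMem h, abs_zero]; exact hA0
  -- the two products and their difference
  have hPm : Measurable (uncurry fun s x => at' s x * F s x) := hat'm.mul hF
  have hPb : ∀ s x, |at' s x * F s x| ≤ A * C := fun s x => by
    rw [abs_mul]; exact mul_le_mul (hat'b s x) (hFb s x) (abs_nonneg _) hA0
  have hQm : Measurable (uncurry fun s x => ac s x * F s x) := hacm.mul hF
  have hQb : ∀ s x, |ac s x * F s x| ≤ A * C := fun s x => by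
    rw [abs_mul]; exact mul_le_mul (hacb s x) (hFb s x) (abs_nonneg _) hA0
  -- the instantaneous side over the long window
  have hinst : ∫ s in Icc 0 t, ∫ x, a (s, x) * F s x = ∫ s in Icc 0 (t + 1), ∫ x, ac s x * F s x := by
    have h1 : ∀ s, ∫ x, ac s x * F s x = (Iic t).indicator (fun s => ∫ x, a (s, x) * F s x) s := by
      intro s
      rw [hac]; dsimp only
      by_cases h : s ∈ Iic t
      · simp only [Set.indicator_of_mem h]
      · simp only [Set.indicator_of_notMem h, zero_mul, integral_zero]
    simp_rw [h1]
    rw [setIntegral_indicator measurableSet_Iic]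
    have hset : Icc 0 (t + 1) ∩ Iic t = Icc 0 t := by
      ext s
      simp only [mem_inter_iff, mem_Icc, mem_Iic]
      constructor
      · rintro ⟨⟨h0, _⟩, h2⟩; exact ⟨h0, h2⟩
      · rintro ⟨h0, h1⟩; exact ⟨⟨h0, by linarith⟩, h1⟩
    rw [hset]
  rw [hinst, ← setIntegral_integral_sub hPm hPb hQm hQb]
  -- the layer weight majorant
  set c : ℝ → ℝ := fun s => ω + 2 * A * ((Icc 0 r).indicator (fun _ => (1 : ℝ)) s +
    (Icc (t - r) (t + r)).indicator (fun _ => (1 : ℝ)) s) with hc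
  have hcm : Measurable c := measurable_layerWeight ω A r t
  have hcmem : ∀ s, 0 ≤ c s ∧ c s ≤ ω + 4 * A := fun s => layerWeight_mem hω0 hA0 r t s
  have hGm : Measurable (uncurry fun s x => c s * (|F s x|)) := (hcm.comp measurable_fst).mul hF.abs
  have hGb : ∀ s x, |c s * (|F s x|)| ≤ (ω + 4 * A) * C := fun s x => by
    rw [abs_mul, abs_of_nonneg (hcmem s).1, abs_abs]
    exact mul_le_mul (hcmem s).2 (hFb s x) (abs_nonneg _) (by linarith)
  -- pointwise domination of the coefficient difference by the layer weight
  have hdiff : ∀ s ∈ Icc 0 (t + 1), ∀ x, |at' s x - ac s x| ≤ c s := by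
    intro s hs x
    have hind1 : ∀ s', s' ∈ Icc 0 r → (Icc 0 r).indicator (fun _ => (1 : ℝ)) s' = 1 := fun s' h => Set.indicator_of_mem h _
    have hind2 : ∀ s', s' ∈ Icc (t - r) (t + r) → (Icc (t - r) (t + r)).indicator (fun _ => (1 : ℝ)) s' = 1 :=
      fun s' h => Set.indicator_of_mem h _
    have h2A : |at' s x - ac s x| ≤ 2 * A := (abs_sub _ _).trans (by linarith [hat'b s x, hacb s x])
    have hnn1 : 0 ≤ (Icc 0 r).indicator (fun _ => (1 : ℝ)) s := Set.indicator_nonneg (fun _ _ => zero_le_one) _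
    have hnn2 : 0 ≤ (Icc (t - r) (t + r)).indicator (fun _ => (1 : ℝ)) s := Set.indicator_nonneg (fun _ _ => zero_le_one) _
    by_cases h1 : s ∈ Icc 0 r
    · simp only [hc, hind1 s h1]; nlinarith
    · by_cases h2 : s ∈ Icc (t - r) (t + r)
      · simp only [hc, hind2 s h2]; nlinarith
      · -- interior or past the window
        simp only [mem_Icc, not_and_or, not_le] at h1 h2
        have hsr : r < s := by rcases h1 with h1 | h1 <;> [linarith [hs.1]; exact h1]
        by_cases hst : s ≤ t
        · -- interior: `r ≤ s`, `s + r ≤ t`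
          have hsr2 : s + r ≤ t := by
            rcases h2 with h2 | h2
            · linarith
            · linarith
          have hacs : ac s x = a (s, x) := by rw [hac]; dsimp only; rw [Set.indicator_of_mem (show s ∈ Iic t from hst)]
          rw [hacs]
          have h := abs_smoothCoeff_sub_le ha hr hr2 hsr.le hsr2 (x := x) (κ := ω) (fun t₀ x₀ h1 h2 => hω s t₀ x x₀ h1 h2)
          calc |at' s x - a (s, x)| ≤ ω := h
            _ ≤ c s := by simp only [hc]; nlinarith
        · -- past the window: both vanish
          push Not at hst
          have hsr3 : t + r ≤ s := by
            rcases h2 with h2 | h2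
            · linarith
            · linarith
          have h0 : at' s x = 0 := smoothCoeff_eq_zero a hr hsr3 x
          have hacs : ac s x = 0 := by
            rw [hac]; dsimp only; rw [Set.indicator_of_notMem (show s ∉ Iic t from fun h => absurd h (not_le.2 hst))]
          rw [h0, hacs, sub_zero, abs_zero]; exact (hcmem s).1
  have hdom : ∀ s ∈ Icc 0 (t + 1), ∀ x, |at' s x * F s x - ac s x * F s x| ≤ c s * (|F s x|) := by
    intro s hs x
    rw [← sub_mul, abs_mul]
    exact mul_le_mul_of_nonneg_right (hdiff s hs x) (abs_nonneg _)
  refine (abs_setIntegral_integral_le_of_le hGm hGb hdom).trans ?_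
  -- `∫∫ c |F| ≤ B₁ ∫ c ≤ B₁ (ω (t+1) + 6 A r)`
  have hslice : ∀ s, ∫ x, c s * (|F s x|) ≤ c s * B₁ := fun s => by
    rw [integral_const_mul]; exact mul_le_mul_of_nonneg_left (hB₁ s) (hcmem s).1
  have hIc : IntegrableOn (fun s => c s * B₁) (Icc 0 (t + 1)) volume := by
    haveI : IsFiniteMeasure ((volume : Measure ℝ).restrict (Icc 0 (t + 1))) :=
      ⟨by rw [Measure.restrict_apply_univ, Real.volume_Icc]; exact ENNReal.ofReal_lt_top⟩
    exact Integrable.of_bound (hcm.mul_const _).aestronglyMeasurable ((ω + 4 * A) * B₁)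
      (ae_of_all _ fun s => by
        rw [Real.norm_eq_abs, abs_mul, abs_of_nonneg (hcmem s).1, abs_of_nonneg hB₁0]
        exact mul_le_mul_of_nonneg_right (hcmem s).2 hB₁0)
  calc ∫ s in Icc 0 (t + 1), ∫ x, c s * (|F s x|) ≤ ∫ s in Icc 0 (t + 1), c s * B₁ :=
        setIntegral_mono_on (integrableOn_integral_slice hGm hGb 0 (t + 1)) hIc measurableSet_Icc fun s _ => hslice s
    _ = (∫ s in Icc 0 (t + 1), c s) * B₁ := integral_mul_const _ _
    _ ≤ (ω * (t + 1) + 6 * A * r) * B₁ :=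
        mul_le_mul_of_nonneg_right (setIntegral_layerWeight_le hA0 hr.le (by linarith) t) hB₁0
    _ = B₁ * (ω * (t + 1) + 6 * A * r) := mul_comm _ _

end Layer

/-! ## Registered sub-goal -/

/-- **Registered sub-goal `stub_pressureValueH` (helper H of `stub_pressureValueOfEnskog`): the cone
quadratic-tail moment is at most twice the cone kinetic energy density.** [folklore] -/
theorem stub_pressureValueH : ∀ {N : ℕ} {r : ℝ}, 0 < r → ∀ (w : Phase N) (x : T3) (L : ℝ), ChaosClosesEulerStressIsotropy.MpsiC r w x (ChaosClosesEulerStressIsotropy.sqTail L) ≤ 2 * kinC r w x :=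
  fun hr w x L => MpsiC_sqTail_le_two_kinC hr w x L

end Summit.AtomisticToContinuum.HydrodynamicLimit.Theorems.ChaosClosesEulerPressureValue

end
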